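import Summits.AtomisticToContinuum.Crystallization.Theorems.SeparationCeilingDoor
import HarnessLib

/-!
# ContactSaturationLadderHoleDepth — hole depth `2e⋆` in Lennard-Jones ground states, and the brush count (helper, supports item 30303)

Helper for route `ContactSaturationLadder`, crux `LooseTextureRung` (stmt-AtomisticToContinuum-30303), registered line
«SieveDepthLadder» v4 (lens-1); critic RULING 2026-08-30 (bus l.823, LINEAGE lens-1 #5′ / (λ′)): the cavity dial is retired at
`T := −2·e⋆` BY NAME, where the door `IncrementFloor (−2e⋆)` is the tree theorem `SeparationCeilingDoor.incrementFloor_two_eStar`.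

§1 **Hole depth.** In a Lennard-Jones ground state `y` on `N` particles no empty point binds a test particle by more than `2|e⋆|`:
`IsGroundState y → q ∉ y → 2·e⋆ ≤ Σ_k V_LJ(|q − y_k|)` (`holeDepth`). Proof: adjoin a particle at `q` (`Fin.cons`, an admissible
`(N+1)`-configuration, `groundStateEnergy_lennardJones_le`) so `E(N+1) − E(N) ≤ Σ_k V_LJ(|q − y_k|)` (`increment_le_insertion`, the
all-`N` form of `GrandCanonicalSelectionKosselPointwise.increment_le_insertion`), and `2e⋆ ≤ E(N+1) − E(N)` is
`incrementFloor_two_eStar`. Consequence: the cavity clause `∀ q ∈ B(p,2ρ₁) ∖ y, −T ≤ Σ_k V_LJ(|q − y_k|)` of the v4 stubs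
`stub_farGap26` / `stub_nearGap26` is AUTOMATIC at `T = −2e⋆` (`cavityClause_two_eStar`, the exact clause shape), so line v5 may
delete it.

§2 **Brush count** (critic TAG 74 (3), «per-defect price ÷ brush count»; pure packing geometry over the tree's
`card_le_of_separated_of_dist_le`): a `δ`-separated set of labels inside a ball of radius `R` has at most `(2R/δ + 1)³` members
(`card_le_of_sep_of_dist_le`; ground-state forms via `SeparationCeilingDoor.SepGS`), and if every label of `L` lies within `R` of
some label of `S` («`S` brushes `L` with reach `R`») then `#L ≤ (2R/δ + 1)³ · #S` (`card_le_mul_card_of_brushed`) and a price `c`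
per label of `S` is a price `c / (2R/δ + 1)³` per label of `L` (`price_div_brush_mul_card_le`). Numerics (not formalised, for the
provers' docstrings): at reach `R = 6.7` and separation `δ = 3/4` the rigorous brush is `(2·6.7/0.75 + 1)³ ≈ 6.7·10³` (≈ `5·10³`
with a density constant), not the physical `≈ 1.3·10³` of the census — irrelevant for an `∃ κ > 0` statement.
-/

noncomputable section

open scoped BigOperators
open Literature.MathematicalPhysics.StatisticalMechanics
open Summit.AtomisticToContinuum.Crystallization.Theorems

namespace Summit.AtomisticToContinuum.Crystallization.Theorems.ContactSaturationLadderHoleDepth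

/-! ## §1 Insertion and hole depth -/

/-- Adjoining a particle at `q` to `y` adds exactly its insertion energy `Σ_k V_LJ(|q − y_k|)`. [folklore] -/
theorem interactionEnergy_cons {N : ℕ} (q : EuclideanSpace ℝ (Fin 3)) (y : Fin N → EuclideanSpace ℝ (Fin 3)) :
    interactionEnergy lennardJones (Fin.cons q y : Fin (N + 1) → EuclideanSpace ℝ (Fin 3))
      = interactionEnergy lennardJones y + ∑ k : Fin N, lennardJones (dist q (y k)) := by
  set y' : Fin (N + 1) → EuclideanSpace ℝ (Fin 3) := Fin.cons q y with hy'
  have hsplit := interactionEnergy_eq_succAbove_add_siteEnergy lennardJones lennardJones_zero y' 0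
  have hcomp : y' ∘ (0 : Fin (N + 1)).succAbove = y := by
    funext k
    simp [y']
  have hsite : siteEnergy lennardJones y' 0 = ∑ k : Fin N, lennardJones (dist q (y k)) := by
    rw [siteEnergy_eq_sum_succAbove]
    simp [y']
  rw [hcomp, hsite] at hsplit
  exact hsplit

/-- `Fin.cons q y` is injective when `y` is and `q` is an empty point. [folklore] -/
theorem cons_injective {N : ℕ} {q : EuclideanSpace ℝ (Fin 3)} {y : Fin N → EuclideanSpace ℝ (Fin 3)}
    (hy : Function.Injective y) (hq : ∀ k : Fin N, q ≠ y k) :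
    Function.Injective (Fin.cons q y : Fin (N + 1) → EuclideanSpace ℝ (Fin 3)) := by
  refine Fin.cons_injective_iff.2 ⟨?_, hy⟩
  rintro ⟨k, hk⟩
  exact hq k hk.symm

/-- **Insertion bound** (all `N`): in a ground state on `N` particles every empty point `q` has
`E(N+1) − E(N) ≤ Σ_k V_LJ(|q − y_k|)`. [folklore] -/
theorem increment_le_insertion {N : ℕ} {y : Fin N → EuclideanSpace ℝ (Fin 3)} (hy : IsGroundState lennardJones y)
    (q : EuclideanSpace ℝ (Fin 3)) (hq : ∀ k : Fin N, q ≠ y k) :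
    groundStateEnergy lennardJones 3 (N + 1) - groundStateEnergy lennardJones 3 N
      ≤ ∑ k : Fin N, lennardJones (dist q (y k)) := by
  have hle : groundStateEnergy lennardJones 3 (N + 1)
      ≤ interactionEnergy lennardJones (Fin.cons q y : Fin (N + 1) → EuclideanSpace ℝ (Fin 3)) :=
    groundStateEnergy_lennardJones_le (cons_injective hy.1 hq)
  rw [interactionEnergy_cons, hy.2] at hle
  linarith

/-- The same with the emptiness hypothesis as `q ∉ Set.range y`. [folklore] -/
theorem increment_le_insertion' {N : ℕ} {y : Fin N → EuclideanSpace ℝ (Fin 3)} (hy : IsGroundState lennardJones y)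
    {q : EuclideanSpace ℝ (Fin 3)} (hq : q ∉ Set.range y) :
    groundStateEnergy lennardJones 3 (N + 1) - groundStateEnergy lennardJones 3 N
      ≤ ∑ k : Fin N, lennardJones (dist q (y k)) :=
  increment_le_insertion hy q fun k hk => hq ⟨k, hk.symm⟩

/-- **HOLE DEPTH.** In a Lennard-Jones ground state no empty point binds a test particle by more than `2|e⋆|`:
`2·e⋆ ≤ Σ_k V_LJ(|q − y_k|)` (`e⋆ = ChargedEnergyGapNegative.eStar`, the periodic infimum). [folklore] -/
theorem holeDepth {N : ℕ} {y : Fin N → EuclideanSpace ℝ (Fin 3)} (hy : IsGroundState lennardJones y)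
    (q : EuclideanSpace ℝ (Fin 3)) (hq : ∀ k : Fin N, q ≠ y k) :
    2 * ChargedEnergyGapNegative.eStar ≤ ∑ k : Fin N, lennardJones (dist q (y k)) := by
  have h1 := increment_le_insertion hy q hq
  have h2 : -(-(2 * SeparationCeilingDoor.eInf))
      ≤ groundStateEnergy lennardJones 3 (N + 1) - groundStateEnergy lennardJones 3 N :=
    SeparationCeilingDoor.incrementFloor_two_eStar N
  rw [neg_neg] at h2
  exact le_trans h2 h1

/-- Hole depth, `Set.range` form. [folklore] -/
theorem holeDepth' {N : ℕ} {y : Fin N → EuclideanSpace ℝ (Fin 3)} (hy : IsGroundState lennardJones y)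
    {q : EuclideanSpace ℝ (Fin 3)} (hq : q ∉ Set.range y) :
    2 * ChargedEnergyGapNegative.eStar ≤ ∑ k : Fin N, lennardJones (dist q (y k)) :=
  holeDepth hy q fun k hk => hq ⟨k, hk.symm⟩

/-- Hole depth with `e⋆` spelled as the raw infimum (the spelling of the registered stubs). [folklore] -/
theorem holeDepth_iInf {N : ℕ} {y : Fin N → EuclideanSpace ℝ (Fin 3)} (hy : IsGroundState lennardJones y)
    (q : EuclideanSpace ℝ (Fin 3)) (hq : ∀ k : Fin N, q ≠ y k) :
    2 * (⨅ Q : PeriodicConfiguration 3, Q.energyPerParticle lennardJones) ≤ ∑ k : Fin N, lennardJones (dist q (y k)) :=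
  holeDepth hy q hq

/-- Hole depth in DOOR form `−T ≤ …` at `T = −2e⋆` (`SeparationCeilingDoor.eInf = e⋆`). [folklore] -/
theorem holeDepth_door {N : ℕ} {y : Fin N → EuclideanSpace ℝ (Fin 3)} (hy : IsGroundState lennardJones y)
    (q : EuclideanSpace ℝ (Fin 3)) (hq : ∀ k : Fin N, q ≠ y k) :
    -(-(2 * SeparationCeilingDoor.eInf)) ≤ ∑ k : Fin N, lennardJones (dist q (y k)) := by
  rw [neg_neg]
  exact holeDepth hy q hq

/-- **The cavity clause of the v4 stubs is automatic at `T = −2e⋆`**: for every ground state `y`, centre `p` and radius `ρ`,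
`∀ q, dist q p ≤ ρ → (∀ k, q ≠ y k) → −(−(2e⋆)) ≤ Σ_k V_LJ(dist q (y k))` (exact clause shape, radius irrelevant). [folklore] -/
theorem cavityClause_two_eStar {N : ℕ} {y : Fin N → EuclideanSpace ℝ (Fin 3)} (hy : IsGroundState lennardJones y)
    (p : EuclideanSpace ℝ (Fin 3)) (ρ : ℝ) :
    ∀ q : EuclideanSpace ℝ (Fin 3), dist q p ≤ ρ → (∀ k : Fin N, q ≠ y k) →
      -(-(2 * (⨅ Q : PeriodicConfiguration 3, Q.energyPerParticle lennardJones))) ≤ ∑ k : Fin N, lennardJones (dist q (y k)) :=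
  fun q _ hq => holeDepth_door hy q hq

/-- Any door `T ≥ 2|e⋆|` makes the `T`-cavity clause automatic. [folklore] -/
theorem cavityClause_of_le {T : ℝ} (hT : -(2 * ChargedEnergyGapNegative.eStar) ≤ T) {N : ℕ}
    {y : Fin N → EuclideanSpace ℝ (Fin 3)} (hy : IsGroundState lennardJones y) (p : EuclideanSpace ℝ (Fin 3)) (ρ : ℝ) :
    ∀ q : EuclideanSpace ℝ (Fin 3), dist q p ≤ ρ → (∀ k : Fin N, q ≠ y k) → -T ≤ ∑ k : Fin N, lennardJones (dist q (y k)) :=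
  fun q _ hq => by
    have := holeDepth hy q hq
    linarith

/-! ## §2 The brush count (packing index over `card_le_of_separated_of_dist_le`) -/

/-- **INDEX FORM of the packing bound.** A `δ`-separated (`δ > 0`) set `S` of labels whose particles lie in the closed ball
`B(p, R)` (`R ≥ 0`) has at most `(2R/δ + 1)³` members. [folklore] -/
theorem card_le_of_sep_of_dist_le {N : ℕ} (y : Fin N → EuclideanSpace ℝ (Fin 3)) (S : Finset (Fin N))
    (p : EuclideanSpace ℝ (Fin 3)) {δ R : ℝ} (hδ : 0 < δ) (hR : 0 ≤ R) (hS : ∀ i ∈ S, dist (y i) p ≤ R)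
    (hsep : ∀ i ∈ S, ∀ j ∈ S, i ≠ j → δ ≤ dist (y i) (y j)) : (S.card : ℝ) ≤ (2 * R / δ + 1) ^ 3 := by
  classical
  have hinj : Set.InjOn y ↑S := by
    intro i hi j hj hij
    by_contra hne
    have h := hsep i hi j hj hne
    rw [hij, dist_self] at h
    linarith
  have hcard : (S.image y).card = S.card := Finset.card_image_of_injOn hinj
  have h := card_le_of_separated_of_dist_le (S.image y) p hδ hR ?_ ?_
  · rw [hcard, finrank_euclideanSpace_fin] at h
    exact h
  · intro c hc
    obtain ⟨i, hi, rfl⟩ := Finset.mem_image.1 hc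
    exact hS i hi
  · intro c hc d hd hcd
    obtain ⟨i, hi, rfl⟩ := Finset.mem_image.1 hc
    obtain ⟨j, hj, rfl⟩ := Finset.mem_image.1 hd
    exact hsep i hi j hj fun h => hcd (by rw [h])

/-- **Ball count** for a globally `δ`-separated configuration: at most `(2R/δ + 1)³` particles in any ball of radius `R`. [folklore] -/
theorem card_ball_le_of_sep {N : ℕ} {y : Fin N → EuclideanSpace ℝ (Fin 3)} {δ : ℝ} (hδ : 0 < δ)
    (hsep : ∀ i j : Fin N, i ≠ j → δ ≤ dist (y i) (y j)) (p : EuclideanSpace ℝ (Fin 3)) {R : ℝ} (hR : 0 ≤ R) :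
    ((Finset.univ.filter fun i : Fin N => dist (y i) p ≤ R).card : ℝ) ≤ (2 * R / δ + 1) ^ 3 :=
  card_le_of_sep_of_dist_le y _ p hδ hR (fun _ hi => (Finset.mem_filter.1 hi).2) fun i _ j _ hij => hsep i j hij

/-- **Ground-state ball count** under `SepGS δ` (tree: `SeparationCeilingDoor.sepGS_pos` gives some `δ > 0`;
`sepGS_of_yuhjtman` gives `δ = 0.684` from the named fact). [folklore] -/
theorem card_ball_le_of_sepGS {δ : ℝ} (hδ : 0 < δ) (hS : SeparationCeilingDoor.SepGS δ) {N : ℕ}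
    {y : Fin N → EuclideanSpace ℝ (Fin 3)} (hy : IsGroundState lennardJones y) (p : EuclideanSpace ℝ (Fin 3)) {R : ℝ}
    (hR : 0 ≤ R) : ((Finset.univ.filter fun i : Fin N => dist (y i) p ≤ R).card : ℝ) ≤ (2 * R / δ + 1) ^ 3 :=
  card_ball_le_of_sep hδ (fun i j hij => hS N y hy i j hij) p hR

/-- Unconditional ground-state ball count: SOME cubic bound `(2R/δ + 1)³`, `δ > 0` universal. [folklore] -/
theorem exists_card_ball_le_of_isGroundState :
    ∃ δ : ℝ, 0 < δ ∧ ∀ (N : ℕ) (y : Fin N → EuclideanSpace ℝ (Fin 3)), IsGroundState lennardJones y →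
      ∀ (p : EuclideanSpace ℝ (Fin 3)) (R : ℝ), 0 ≤ R →
        ((Finset.univ.filter fun i : Fin N => dist (y i) p ≤ R).card : ℝ) ≤ (2 * R / δ + 1) ^ 3 := by
  obtain ⟨δ, hδ, hS⟩ := SeparationCeilingDoor.sepGS_pos
  exact ⟨δ, hδ, fun N y hy p R hR => card_ball_le_of_sepGS hδ hS hy p hR⟩

/-- **BRUSH COUNT (double counting).** If every label of `L` lies within `R` of some label of `S` («`S` brushes `L` with reach
`R ≥ 0`») and `L` is `δ`-separated (`δ > 0`), then `#L ≤ (2R/δ + 1)³ · #S`. [folklore] -/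
theorem card_le_mul_card_of_brushed {N : ℕ} (y : Fin N → EuclideanSpace ℝ (Fin 3)) (L S : Finset (Fin N)) {δ R : ℝ}
    (hδ : 0 < δ) (hR : 0 ≤ R) (hsep : ∀ i ∈ L, ∀ j ∈ L, i ≠ j → δ ≤ dist (y i) (y j))
    (hbrush : ∀ i ∈ L, ∃ k ∈ S, dist (y i) (y k) ≤ R) : (L.card : ℝ) ≤ (2 * R / δ + 1) ^ 3 * S.card := by
  classical
  have hsub : L ⊆ S.biUnion fun k => L.filter fun i => dist (y i) (y k) ≤ R := by
    intro i hi
    obtain ⟨k, hk, hik⟩ := hbrush i hi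
    exact Finset.mem_biUnion.2 ⟨k, hk, Finset.mem_filter.2 ⟨hi, hik⟩⟩
  have h1 : L.card ≤ ∑ k ∈ S, (L.filter fun i => dist (y i) (y k) ≤ R).card :=
    (Finset.card_le_card hsub).trans Finset.card_biUnion_le
  have h2 : ∀ k ∈ S, ((L.filter fun i => dist (y i) (y k) ≤ R).card : ℝ) ≤ (2 * R / δ + 1) ^ 3 := fun k _ =>
    card_le_of_sep_of_dist_le y _ (y k) hδ hR (fun i hi => (Finset.mem_filter.1 hi).2)
      fun i hi j hj hij => hsep i (Finset.mem_filter.1 hi).1 j (Finset.mem_filter.1 hj).1 hij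
  calc (L.card : ℝ) ≤ ((∑ k ∈ S, (L.filter fun i => dist (y i) (y k) ≤ R).card : ℕ) : ℝ) := by exact_mod_cast h1
    _ = ∑ k ∈ S, ((L.filter fun i => dist (y i) (y k) ≤ R).card : ℝ) := by push_cast; rfl
    _ ≤ ∑ k ∈ S, (2 * R / δ + 1) ^ 3 := Finset.sum_le_sum h2
    _ = (2 * R / δ + 1) ^ 3 * S.card := by rw [Finset.sum_const, nsmul_eq_mul, mul_comm]

/-- Brush count for a globally `δ`-separated configuration. [folklore] -/
theorem card_le_mul_card_of_brushed_of_sep {N : ℕ} {y : Fin N → EuclideanSpace ℝ (Fin 3)} {δ : ℝ} (hδ : 0 < δ)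
    (hsep : ∀ i j : Fin N, i ≠ j → δ ≤ dist (y i) (y j)) (L S : Finset (Fin N)) {R : ℝ} (hR : 0 ≤ R)
    (hbrush : ∀ i ∈ L, ∃ k ∈ S, dist (y i) (y k) ≤ R) : (L.card : ℝ) ≤ (2 * R / δ + 1) ^ 3 * S.card :=
  card_le_mul_card_of_brushed y L S hδ hR (fun i _ j _ hij => hsep i j hij) hbrush

/-- **Per-defect price ÷ brush count.** Under the brush hypothesis, a price `c ≥ 0` per label of `S` is a price
`c / (2R/δ + 1)³` per label of `L`: `(c / (2R/δ + 1)³) · #L ≤ c · #S`. [folklore] -/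
theorem price_div_brush_mul_card_le {N : ℕ} (y : Fin N → EuclideanSpace ℝ (Fin 3)) (L S : Finset (Fin N)) {δ R c : ℝ}
    (hδ : 0 < δ) (hR : 0 ≤ R) (hc : 0 ≤ c) (hsep : ∀ i ∈ L, ∀ j ∈ L, i ≠ j → δ ≤ dist (y i) (y j))
    (hbrush : ∀ i ∈ L, ∃ k ∈ S, dist (y i) (y k) ≤ R) :
    c / (2 * R / δ + 1) ^ 3 * L.card ≤ c * S.card := by
  have hM : 0 < (2 * R / δ + 1) ^ 3 := by positivity
  have h := card_le_mul_card_of_brushed y L S hδ hR hsep hbrush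
  calc c / (2 * R / δ + 1) ^ 3 * L.card ≤ c / (2 * R / δ + 1) ^ 3 * ((2 * R / δ + 1) ^ 3 * S.card) :=
        mul_le_mul_of_nonneg_left h (div_nonneg hc hM.le)
    _ = c * S.card := by
        field_simp

/-- The price per brushed label is positive when the price per core is. [folklore] -/
theorem price_div_brush_pos {δ R c : ℝ} (hδ : 0 < δ) (hR : 0 ≤ R) (hc : 0 < c) : 0 < c / (2 * R / δ + 1) ^ 3 := by
  positivity

end Summit.AtomisticToContinuum.Crystallization.Theorems.ContactSaturationLadderHoleDepth

end
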